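import Summits.BirchSwinnertonDyer.Rank1Residual.Additive.X4QuadraticBranchLowerDatum
import Summits.BirchSwinnertonDyer.Rank1Residual.Additive.X3BranchLowerDescent
import HarnessLib

/-!
# X3 on the semistable-twist locus: NON-VACUITY of the `ω^{(p−1)/2}`-branch conjectures' telescope
# (`X3BranchMainConjectureAt` / `X3BranchLambdaEqAt` / `X3BranchAnalyticMuZeroAt`, row T-c2x3) on
# every X3♯(M) and X3♯(G-ord, `e = 2`) pair (cell `b2b-bsdres`, team n1011, seat p12 (gen 2);
# the X3 twin of seat p07's `X4QuadraticBranchLowerDatum.lean`, written at p07's hand-over 06:34Z)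

HONEST FRAMING (cell `b2b-bsdres`, run/shared/lean/b2b/bsd-rank1-residual/, verbatim in every
file): the goal of the cell is to DELETE the COMBINATION-SHAPED residual classes of the
Birch–Swinnerton-Dyer formula for ALL analytic-rank `≤ 1` elliptic curves over `ℚ` — "full BSD
formula for every rank `≤ 1` curve in class `C`" assembled STRICTLY from published theorems — so
that the rank-`≤ 1` remainder becomes exactly the CONSTRUCTION-SHAPED classes, which are TYPED
(missing-input `Prop`s), NOT attempted. This is not "finishing BSD". Team n1011 (RESIDUAL-MAP §I
N10), seat `b2b-bsdres-n1011-p12` (gen 2), row T-c2x3 (v) postscript: research route on the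
CONSTRUCTION-SHAPED class X3; labels and marks UNCHANGED; nothing booked; NO Literature fact
minted; THEOREMS ONLY (existence statements built from tree theorems; 0 named facts).

## What and why

The end-state theorems of `X3BranchLowerDescent.lean` / `X3BranchLowerEndState.lean` take the X3
branch inputs universally over the twist models `V` of `W` (`hMC` / `hlam` / `hμ`), and each typed
item (`X3BranchMainConjectureAt V p` etc.) is itself a `∀` over a long telescope (`K`, `F`, `κ`, `γ`,
`f`, `B`, the reduction disjunction, `¬ Irr V p`, a half-eigen `Λ`-dual datum
`D : V.EigenSelmerDualData p (ker κ ⊓ galRange K ⊓ galRange F) (ker κ) χ_K γ`, `ϖ`). Route planner 2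
(ROUTE-2 II.4.4) asked for a VACUITY PASS: is that telescope inhabited on the rows the class theorems
name? Seat p07 answered on X4 (`X4QuadraticBranchLowerDatum.lean`, core
`exists_quadraticBranchLowerDatum_of_twist`); here the X3 side: on every X3♯(M) pair (odd `p`) and
every additive (G)-ordinary defect-`2` pair with `E[p]` reducible there is a twist model `V`
(`C • V^{(p*)} = W`, `V[p]` reducible by additive-p1's `irr_iff_of_model_twist`) carrying a FULL
binder tuple of `X3BranchMainConjectureAt V p` — the cell datum of p07's core read as a Literature
eigen datum by additive-p1's `ChiEigenSelmerInDualData.toEigen`. So the conditional class theorems of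
row T-c2x3 (v) are NOT vacuously true: `ClassX3M.exists_x3BranchDatum`,
`ClassX3Gord.exists_x3BranchDatum_of_semistabilityIndex_eq_two`. Nothing booked.

References: [GreenbergLNM1716] §5; [EdixhovenManin1991] §1; [Wuthrich2014] Thm. 16 (binder shape
only); [MazurTateTeitelbaum1986Invent] §I.13–I.14.
-/

noncomputable section

open scoped Classical MatrixGroups ModularForm NumberField

namespace Summit.BirchSwinnertonDyer.Rank1Residual.Additive

open CongruenceSubgroup WeierstrassCurve NumberField Literature.NumberTheory.EllipticCurves
  Literature.NumberTheory.EllipticCurves.ModularForms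
  Literature.NumberTheory.EllipticCurves.Rank1Residual
  Literature.NumberTheory.EllipticCurves.Rank1Residual.Typed
  Literature.NumberTheory.GaloisRepresentations
  Summit.BirchSwinnertonDyer.Rank1Residual.AdditivePotMult
  IsDedekindDomain Rat.HeightOneSpectrum

variable {W : WeierstrassCurve ℚ} [W.IsElliptic] [W.IsGloballyMinimal] {p : ℕ} [hp : Fact p.Prime]

/-! ### §1 Core: a semistable twist model of a reducible `W` carries a full half-eigen telescope -/

omit [W.IsGloballyMinimal] in
/-- **Core (twist-model level), every odd `p`**: for `W[p]` reducible and a globally minimal `V`,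
good ordinary OR multiplicative at `p`, with `C • V^{(p*)} = W`, the binder telescope of
`X3Branch.X3BranchMainConjectureAt V p` is INHABITED — `K`, `F = ℚ(ζ_p)`, cyclotomic `κ`, a
normalised generator `γ`, the newform, a branch series in the reduction disjunction, `V[p]`
reducible, a half-eigen `Λ`-dual datum in Wuthrich's `EigenSelmerDualData` vocabulary (p07's cell
datum through `ChiEigenSelmerInDualData.toEigen`) and a period ratio of the right parity.
[cite: GreenbergLNM1716, §5 (PDF p. 143)] [cite: EdixhovenManin1991, §1] -/
theorem X3Branch.exists_datum_of_twist (hmodD : nonempty_modularParametrizationData)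
    (hp2 : p ≠ 2) (hredW : ¬ Irr W p)
    {V : WeierstrassCurve ℚ} [V.IsElliptic] [V.IsGloballyMinimal] {C : VariableChange ℚ}
    (hC : C • V.quadraticTwist ((-1 : ℚ) ^ (p / 2) * p) = W) (hred : GoodOrd V p ∨ Mult V p) :
    ∃ (K : Type) (_ : Field K) (_ : NumberField K) (_ : (galRange (K := ℚ) K).Normal)
      (F : Type) (_ : Field F) (_ : NumberField F) (_ : IsCyclotomicExtension {p} ℚ F)
      (_ : (galRange (K := ℚ) F).Normal)
      (κ : ZpExtension ℚ p) (γ : Field.absoluteGaloisGroup ℚ) (N : ℕ) (_ : NeZero N)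
      (f : CuspForm (Gamma0 N) 2) (B : PowerSeries ℚ_[p])
      (_ : V.EigenSelmerDualData p
        (κ.kerSubgroup ⊓ galRange (K := ℚ) K ⊓ galRange (K := ℚ) F) κ.kerSubgroup
        (fun g ↦ if g ∈ galRange (K := ℚ) K then 1 else -1) γ) (ϖ : ℚ),
      Module.finrank ℚ K = 2 ∧ (∃ θ : K, θ ^ 2 = algebraMap ℚ K ((-1) ^ (p / 2) * p)) ∧
      ((IsOrdinaryAt V p ∧
          B = if Even (p / 2) then padicLFunctionBranch f ((unitRoot V p : ℤ_[p]) : ℚ_[p]) (p / 2)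
            else padicLFunctionMinusBranch f ((unitRoot V p : ℤ_[p]) : ℚ_[p]) (p / 2)) ∨
        (V.HasSplitMultiplicativeReductionAtPrime p ∧
          B = if Even (p / 2) then padicLFunctionPlusBranchMult f (1 : ℚ_[p]) (p / 2)
            else padicLFunctionMinusBranchMult f (1 : ℚ_[p]) (p / 2)) ∨
        (V.HasMultiplicativeReductionAtPrime p ∧ ¬ V.HasSplitMultiplicativeReductionAtPrime p ∧
          B = if Even (p / 2) then padicLFunctionPlusBranchMult f (-1 : ℚ_[p]) (p / 2)
            else padicLFunctionMinusBranchMult f (-1 : ℚ_[p]) (p / 2))) ∧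
      ¬ V.HasIrreducibleModPGaloisRep p ∧
      κ.IsCyclotomic ∧ κ.IsTopGenerator γ ∧ IsCyclotomicVariable p γ ∧
      γ ∈ galRange (K := ℚ) K ∧ γ ∈ galRange (K := ℚ) F ∧ IsNewformOf V f ∧
      (if Even (p / 2) then (ϖ : ℝ) * V.realPeriodRat = plusPeriod f
        else (ϖ : ℝ) * V.imaginaryPeriodRat = minusPeriod f) := by
  have hpS : ((-1 : ℚ) ^ (p / 2) * p) ≠ 0 :=
    mul_ne_zero (pow_ne_zero _ (by norm_num)) (Nat.cast_ne_zero.mpr hp.out.ne_zero)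
  have hirrV : ¬ V.HasIrreducibleModPGaloisRep p :=
    fun hV ↦ hredW ((irr_iff_of_model_twist (W := V) (p := p) hpS ⟨C, hC⟩).mpr hV)
  obtain ⟨K, iK1, iK2, iK3, F, iF1, iF2, iF3, iF4, κ, γ, N, iN, f, B, D, ϖ, hK2, hθ, hB, hκ, hγ, hcv,
    hγK, hγF, hf, hϖ⟩ := exists_quadraticBranchLowerDatum_of_twist hmodD hp2 hC hred
  exact ⟨K, iK1, iK2, iK3, F, iF1, iF2, iF3, iF4, κ, γ, N, iN, f, B,
    ChiEigenSelmerInDualData.toEigen V K κ (galRange (K := ℚ) F) γ D, ϖ, hK2, hθ, hB, hirrV, hκ, hγ,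
    hcv, hγK, hγF, hf, hϖ⟩

/-! ### §2 Class level: X3♯(M) and the reducible additive (G)-ordinary defect-2 rows -/

/-- **NON-VACUITY on X3♯(M), every odd `p`**: on every X3♯(M) pair there is a globally minimal twist
model `V`, MULTIPLICATIVE at `p`, with `C • V^{(p*)} = W` (additive-p1's
`ClassX3M.exists_mult_pStar_twist_model`) carrying a full binder tuple of
`X3Branch.X3BranchMainConjectureAt V p` (§1). So the hypotheses `hMC` / `hlam` / `hμ` of
`ClassX3M.bsdp_rankZero_of_forall_x3Branch…` are not vacuous on these rows.
[cite: GreenbergLNM1716, §5 (PDF p. 143)] [cite: EdixhovenManin1991, §1] [cite: SilvermanATAEC1994, V.5.3] -/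
theorem ClassX3M.exists_x3BranchDatum (hmodD : nonempty_modularParametrizationData)
    (hX : ClassX3M W p) :
    ∃ (V : WeierstrassCurve ℚ) (_ : V.IsElliptic) (_ : V.IsGloballyMinimal)
      (K : Type) (_ : Field K) (_ : NumberField K) (_ : (galRange (K := ℚ) K).Normal)
      (F : Type) (_ : Field F) (_ : NumberField F) (_ : IsCyclotomicExtension {p} ℚ F)
      (_ : (galRange (K := ℚ) F).Normal)
      (κ : ZpExtension ℚ p) (γ : Field.absoluteGaloisGroup ℚ) (N : ℕ) (_ : NeZero N)
      (f : CuspForm (Gamma0 N) 2) (B : PowerSeries ℚ_[p])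
      (_ : V.EigenSelmerDualData p
        (κ.kerSubgroup ⊓ galRange (K := ℚ) K ⊓ galRange (K := ℚ) F) κ.kerSubgroup
        (fun g ↦ if g ∈ galRange (K := ℚ) K then 1 else -1) γ) (ϖ : ℚ),
      (∃ C : VariableChange ℚ, C • V.quadraticTwist ((-1) ^ (p / 2) * p : ℚ) = W) ∧ Mult V p ∧
      p ≠ 2 ∧ Module.finrank ℚ K = 2 ∧ (∃ θ : K, θ ^ 2 = algebraMap ℚ K ((-1) ^ (p / 2) * p)) ∧
      ((IsOrdinaryAt V p ∧
          B = if Even (p / 2) then padicLFunctionBranch f ((unitRoot V p : ℤ_[p]) : ℚ_[p]) (p / 2)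
            else padicLFunctionMinusBranch f ((unitRoot V p : ℤ_[p]) : ℚ_[p]) (p / 2)) ∨
        (V.HasSplitMultiplicativeReductionAtPrime p ∧
          B = if Even (p / 2) then padicLFunctionPlusBranchMult f (1 : ℚ_[p]) (p / 2)
            else padicLFunctionMinusBranchMult f (1 : ℚ_[p]) (p / 2)) ∨
        (V.HasMultiplicativeReductionAtPrime p ∧ ¬ V.HasSplitMultiplicativeReductionAtPrime p ∧
          B = if Even (p / 2) then padicLFunctionPlusBranchMult f (-1 : ℚ_[p]) (p / 2)
            else padicLFunctionMinusBranchMult f (-1 : ℚ_[p]) (p / 2))) ∧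
      ¬ V.HasIrreducibleModPGaloisRep p ∧
      κ.IsCyclotomic ∧ κ.IsTopGenerator γ ∧ IsCyclotomicVariable p γ ∧
      γ ∈ galRange (K := ℚ) K ∧ γ ∈ galRange (K := ℚ) F ∧ IsNewformOf V f ∧
      (if Even (p / 2) then (ϖ : ℝ) * V.realPeriodRat = plusPeriod f
        else (ϖ : ℝ) * V.imaginaryPeriodRat = minusPeriod f) := by
  have hp2 : p ≠ 2 := hX.p_ne_two
  obtain ⟨V, iV, iVm, C, hV, hC⟩ := hX.exists_mult_pStar_twist_model
  obtain ⟨K, iK1, iK2, iK3, F, iF1, iF2, iF3, iF4, κ, γ, N, iN, f, B, D, ϖ, hK2, hθ, hB, hirr, hκ, hγ,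
    hcv, hγK, hγF, hf, hϖ⟩ :=
    X3Branch.exists_datum_of_twist (W := W) hmodD hp2 hX.classX3.1 hC (Or.inr hV)
  exact ⟨V, iV, iVm, K, iK1, iK2, iK3, F, iF1, iF2, iF3, iF4, κ, γ, N, iN, f, B, D, ϖ, ⟨C, hC⟩, hV,
    hp2, hK2, hθ, hB, hirr, hκ, hγ, hcv, hγK, hγF, hf, hϖ⟩

/-- **NON-VACUITY on the reducible additive (G)-ordinary defect-2 rows (X3♯(G-ord) ∩ `I₀*`), `p`
odd**: a globally minimal GOOD ORDINARY twist model `V` with `C • V^{(p*)} = W`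
(`TypeGOrd.exists_goodOrd_pStar_twist_model`) carries a full binder tuple of
`X3Branch.X3BranchMainConjectureAt V p` (§1). [cite: GreenbergLNM1716, §5 (PDF p. 143)]
[cite: EdixhovenManin1991, §1] -/
theorem ClassX3Gord.exists_x3BranchDatum_of_semistabilityIndex_eq_two
    (hmodD : nonempty_modularParametrizationData) (hX : ClassX3Gord W p) (hp2 : p ≠ 2)
    (he : semistabilityIndex W p = 2) :
    ∃ (V : WeierstrassCurve ℚ) (_ : V.IsElliptic) (_ : V.IsGloballyMinimal)
      (K : Type) (_ : Field K) (_ : NumberField K) (_ : (galRange (K := ℚ) K).Normal)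
      (F : Type) (_ : Field F) (_ : NumberField F) (_ : IsCyclotomicExtension {p} ℚ F)
      (_ : (galRange (K := ℚ) F).Normal)
      (κ : ZpExtension ℚ p) (γ : Field.absoluteGaloisGroup ℚ) (N : ℕ) (_ : NeZero N)
      (f : CuspForm (Gamma0 N) 2) (B : PowerSeries ℚ_[p])
      (_ : V.EigenSelmerDualData p
        (κ.kerSubgroup ⊓ galRange (K := ℚ) K ⊓ galRange (K := ℚ) F) κ.kerSubgroup
        (fun g ↦ if g ∈ galRange (K := ℚ) K then 1 else -1) γ) (ϖ : ℚ),
      (∃ C : VariableChange ℚ, C • V.quadraticTwist ((-1) ^ (p / 2) * p : ℚ) = W) ∧ GoodOrd V p ∧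
      Module.finrank ℚ K = 2 ∧ (∃ θ : K, θ ^ 2 = algebraMap ℚ K ((-1) ^ (p / 2) * p)) ∧
      ((IsOrdinaryAt V p ∧
          B = if Even (p / 2) then padicLFunctionBranch f ((unitRoot V p : ℤ_[p]) : ℚ_[p]) (p / 2)
            else padicLFunctionMinusBranch f ((unitRoot V p : ℤ_[p]) : ℚ_[p]) (p / 2)) ∨
        (V.HasSplitMultiplicativeReductionAtPrime p ∧
          B = if Even (p / 2) then padicLFunctionPlusBranchMult f (1 : ℚ_[p]) (p / 2)
            else padicLFunctionMinusBranchMult f (1 : ℚ_[p]) (p / 2)) ∨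
        (V.HasMultiplicativeReductionAtPrime p ∧ ¬ V.HasSplitMultiplicativeReductionAtPrime p ∧
          B = if Even (p / 2) then padicLFunctionPlusBranchMult f (-1 : ℚ_[p]) (p / 2)
            else padicLFunctionMinusBranchMult f (-1 : ℚ_[p]) (p / 2))) ∧
      ¬ V.HasIrreducibleModPGaloisRep p ∧
      κ.IsCyclotomic ∧ κ.IsTopGenerator γ ∧ IsCyclotomicVariable p γ ∧
      γ ∈ galRange (K := ℚ) K ∧ γ ∈ galRange (K := ℚ) F ∧ IsNewformOf V f ∧
      (if Even (p / 2) then (ϖ : ℝ) * V.realPeriodRat = plusPeriod f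
        else (ϖ : ℝ) * V.imaginaryPeriodRat = minusPeriod f) := by
  obtain ⟨V, iV, iVm, C, hV, hC⟩ :=
    TypeGOrd.exists_goodOrd_pStar_twist_model W p hp2 hX.typeGOrd hX.addv he
  obtain ⟨K, iK1, iK2, iK3, F, iF1, iF2, iF3, iF4, κ, γ, N, iN, f, B, D, ϖ, hK2, hθ, hB, hirr, hκ, hγ,
    hcv, hγK, hγF, hf, hϖ⟩ :=
    X3Branch.exists_datum_of_twist (W := W) hmodD hp2 hX.classX3.1 hC (Or.inl hV)
  exact ⟨V, iV, iVm, K, iK1, iK2, iK3, F, iF1, iF2, iF3, iF4, κ, γ, N, iN, f, B, D, ϖ, ⟨C, hC⟩, hV,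
    hK2, hθ, hB, hirr, hκ, hγ, hcv, hγK, hγF, hf, hϖ⟩

end Summit.BirchSwinnertonDyer.Rank1Residual.Additive

end
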